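import Summits.ResolutionOfSingularities.ResolutionOfSingularities.Theorems.MarkedTransferCampaignW13Bypass
import Mathlib.Algebra.CharP.Lemmas
import Mathlib.Algebra.CharP.Reduced
import Mathlib.Tactic.ReduceModChar
import Mathlib.Tactic.Ring
import Mathlib.Tactic.LinearCombination
import HarnessLib

/-!
# [OURS · L1 W1.3] Kill test K1.3 on `Campaign.bypassTSharp`: the three identities of the recomputed examples
# B / C / D and their ℘posi-membership certificates (seat res-L1-k13)

LADDER-RESOLUTION rung L (rescue), cell `res-hironaka` (run/shared/lean/pub/res-hironaka/), RESCUE-SEED slot W1.3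
(«ARCHITECTURE BYPASS: drop `℘nega` — `T♯ := 𝔏_0(∞) ∩ ℘posi`»), kill test K1.3 («recompute prior Examples B/C/D …
with `T♯ := L0(∞) ∩ ℘posi` — one kit job + Lean check of the three identities»; pre-registration HOME/STATUS.md
2026-08-26T18:35Z, frozen copy HOME/L/res-L1-k13/PREREG-K1.3.md sha16 f2059b33d40d083f; job of record j259562;
report HOME/L/res-L1-k13/KILL-TEST-K1.3.md). The object is `Campaign.bypassTSharp` of
`MarkedTransferCampaignW13Bypass.lean` (res-L1-type-o2, p461895): §0 records the one lattice fact the test uses about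
it (`bypassTSharp ≤ pposi`). §§1–3 are the kernel-checked polynomial identities behind the recomputation of the three
examples in characteristic 2 — B = `(y²+x₁³x₂³, 2)`, C = the transform of `(y²+x₁x₂³, 2)` at the point `ξ′_b` of the
first blow-up, D = `(y²+x₁x₂³, 2)` — and behind the certificates NEG (an explicit permissible sequence of point
blow-ups whose next centre lies off the strict transform of the tail hypersurface; explicit arcs) and POS (the
knock-out is a multiple of a first Hasse derivative). Hasse derivatives are certified through the Taylor expansions
`f(x + u) = Σ_a (∂^{(a)}f)(x)·u^a` that define them. Helper filed `--supports stmt-ResolutionOfSingularities-15522`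
(host of the G1 OURS files, plan/SIZED-ASK-L.md §S-s13); proofs only, no new objects.

HONEST FRAMING. Nothing here is a statement of H. Hironaka's manuscript *Resolution of singularities in positive
characteristics* (2017-03-23, [Hironaka2017], lit key `paper:url-3343fd9e678b`); the words «head», «tail», «H♭»,
«knock-out» only name the role a polynomial plays in the recomputation (Rem 9.9–9.11 / Def 9.12 p.51, Eq.(83)–(85)
p.53–55 are CANDIDATES [claim: Hironaka2017, status: under-review], used only to FIX WHICH polynomial is computed).
No verdict on GAP-LEDGER rows R01/R04/R08 is implied; kernel facts about explicit polynomials only. AI computation is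
weaker than expert review; nothing here is progress on resolution of singularities in positive characteristic.

CONTENTS (all `[folklore]`, sorry-free): §0 `bypassTSharp_le_pposi`; §1 Example D: `D_taylor`, `D_hflat`, `D_pos`,
`D_nabla_chart`, `D_nabla_taylor`, `D_neg_step1`, `D_neg_step2`, `D_neg_witness`, `D_arc`; §2 Example B: `B_taylor`,
`B_hflat`, `B_neg_steps`, `B_neg_witness`, `B_arc`; §3 Example C: `C_chart`, `C_edge_form`, `C_taylor`, `C_identity`
(the registered identity I_C), `C_pos`, `C_neg`, `C_arc`; §4 pointwise loci over a field: `B_sing_pointwise`,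
`D_sing_pointwise`, `B_nabla_pointwise`, `B_J0_not_in_ysq`.
-/

set_option linter.dupNamespace false -- mandated namespace of this single-conjunct summit

namespace Summit.ResolutionOfSingularities.ResolutionOfSingularities.Theorems.Campaign.K13

section Lattice

open Literature.AlgebraicGeometry.Hironaka2017.S11CoordFree (BlSub)

universe v

variable {O : Type v} [CommRing O] {p : ℕ} [Fact p.Prime] [CharP O p] {ℓ : ℕ}

/-- §0. The one structural fact about the bypass module used by the kill test (reading R-hom): the bypass sharp
tails module lies inside `℘posi` — `𝔏_0(∞) ∩ ℘posi ≤ ℘posi` (pure lattice algebra on the typed carrier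
`Campaign.bypassTSharp` of p461895). Consequence used in KILL-TEST-K1.3.md: every homogeneous element of the bypass
module of degree `d > 0` lies in `℘(Ě,d)`. [folklore] -/
theorem bypassTSharp_le_pposi (L0inf pposi : BlSub O p ℓ) : Campaign.bypassTSharp L0inf pposi ≤ pposi := by
  rw [Campaign.bypassTSharp_eq_inf]
  exact inf_le_right

end Lattice


section Identities

variable {K : Type*} [CommRing K] [CharP K 2]

/-! ## Example D: `g = y² + x₁x₂³` -/

/-- Taylor expansion of `g_D = y² + x₁x₂³` at `(x₁,x₂,y)` in the increments `(u,v,w)`, characteristic 2.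
Read off: `∂_{x₁}g = x₂³`, `∂_{x₂}g = x₁x₂²`, `∂_y g = 0`, `∂^{(1,1,0)}g = x₂²`, `∂^{(0,2,0)}g = x₁x₂`,
`∂^{(0,0,2)}g = 1`, `∂^{(1,2,0)}g = x₂`, `∂^{(0,3,0)}g = x₁`, `∂^{(1,3,0)}g = 1`. [folklore] -/
theorem D_taylor (x₁ x₂ y u v w : K) :
    (y + w) ^ 2 + (x₁ + u) * (x₂ + v) ^ 3 =
      (y ^ 2 + x₁ * x₂ ^ 3) + x₂ ^ 3 * u + x₁ * x₂ ^ 2 * v + x₂ ^ 2 * (u * v) + x₁ * x₂ * v ^ 2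
        + w ^ 2 + x₂ * (u * v ^ 2) + x₁ * v ^ 3 + u * v ^ 3 := by
  ring_nf
  reduce_mod_char!

omit [CharP K 2] in
/-- I_D (H♭): case (III) of Lem 9.6 for `ε = x₁x₂³` (`α = (1,1)`, `γ₀ = (0,1)`, `q = 2`):
`h♭(ε) = ∂^{(1,1)}ε · ∂^{(0,2)}ε = x₂² · x₁x₂ = ε` (hence `(h♭)²(ε) = ε = H`), and the head minus the
knock-out is the square of the tail `y`: `g − H = y²`. [folklore] -/
theorem D_hflat (x₁ x₂ y : K) :
    x₂ ^ 2 * (x₁ * x₂) = x₁ * x₂ ^ 3 ∧ (y ^ 2 + x₁ * x₂ ^ 3) - x₁ * x₂ ^ 3 = y ^ 2 := by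
  constructor <;> ring

omit [CharP K 2] in
/-- POS_D: the knock-out is a multiple of a first Hasse derivative of `g`: `H = x₁ · ∂_{x₁}g`
(`∂_{x₁}g = x₂³` by `D_taylor`). [folklore] -/
theorem D_pos (x₁ x₂ : K) : x₁ * x₂ ^ 3 = x₁ * (x₂ ^ 3) := by ring

omit [CharP K 2] in
/-- I_D (chart of the blow-up of `∇ = {y = x₂ = 0}`, `x₂`-chart `y = x₂y′`):
`g(x₁, x₂, x₂y′) = x₂² · (y′² + x₁x₂)`; the transform `y′² + x₁x₂` has no constant and no linear
part at the origin (order 2 = b), so the chart origin lies in `Sing` of the transform. [folklore] -/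
theorem D_nabla_chart (x₁ x₂ y' : K) :
    (x₂ * y') ^ 2 + x₁ * x₂ ^ 3 = x₂ ^ 2 * (y' ^ 2 + x₁ * x₂) := by ring

/-- Taylor expansion of the `∇`-transform `g′ = y′² + x₁x₂` (characteristic 2): `∂_{x₁}g′ = x₂`,
`∂_{x₂}g′ = x₁`, `∂_{y′}g′ = 0`, and `y′² = g′ + x₁x₂` — the identities behind `Inv_{ξ′} = (3,0,1,1,1)`. [folklore] -/
theorem D_nabla_taylor (x₁ x₂ y u v w : K) :
    (y + w) ^ 2 + (x₁ + u) * (x₂ + v) = (y ^ 2 + x₁ * x₂) + x₂ * u + x₁ * v + u * v + w ^ 2 ∧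
      y ^ 2 = (y ^ 2 + x₁ * x₂) + x₁ * x₂ := by
  constructor
  · ring_nf
    reduce_mod_char!
  · ring_nf
    reduce_mod_char!

omit [CharP K 2] in
/-- NEG-LSB_D, step 1: blow-up of the origin, `x₁`-chart `(x₁, x₁x₂, x₁y)`:
`g(x₁, x₁x₂, x₁y) = x₁² · (y² + x₁²x₂³)`; the tail `y` transforms to `x₁ · y`. [folklore] -/
theorem D_neg_step1 (x₁ x₂ y : K) :
    (x₁ * y) ^ 2 + x₁ * (x₁ * x₂) ^ 3 = x₁ ^ 2 * (y ^ 2 + x₁ ^ 2 * x₂ ^ 3) := by ring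

/-- NEG-LSB_D, step 2: blow-up of the point `(x₁,x₂,y) = (0,1,0)` of the first chart (translate
`x₂ ↦ 1 + x₂`, then `x₁`-chart): `g₁(x₁, 1 + x₁x₂, x₁y) = x₁² · g₂` with
`g₂ = y² + 1 + x₁x₂ + x₁²x₂² + x₁³x₂³` (characteristic 2). [folklore] -/
theorem D_neg_step2 (x₁ x₂ y : K) :
    (x₁ * y) ^ 2 + x₁ ^ 2 * (1 + x₁ * x₂) ^ 3 =
      x₁ ^ 2 * (y ^ 2 + 1 + x₁ * x₂ + x₁ ^ 2 * x₂ ^ 2 + x₁ ^ 3 * x₂ ^ 3) := by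
  ring_nf
  reduce_mod_char!

/-- NEG-LSB_D, witness: at the point `(0,0,1)` of the second chart, `g₂(u, v, 1 + w)` has no
constant and no linear part (order ≥ 2 = b: the point lies in `Sing` of the transform), while the
transformed tail is the coordinate `y`, whose value there is `1 ≠ 0`: the point is a permissible
centre for the transform of `Ě` that is not permissible for the transform of `((y),1)`. [folklore] -/
theorem D_neg_witness (u v w : K) :
    (1 + w) ^ 2 + 1 + u * v + u ^ 2 * v ^ 2 + u ^ 3 * v ^ 3 = w ^ 2 + u * v + u ^ 2 * v ^ 2 + u ^ 3 * v ^ 3 := by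
  ring_nf
  reduce_mod_char!

/-- NEG-VAL_D (axis point `(c²,0,0)`, arc `(x₁,x₂,y) = (c²+s⁶, s², c s³+s⁴)`): along the arc
`g = s⁸ + s¹²`, `∂_{x₁}g = x₂³ = s⁶`, `∂_{x₂}g = x₁x₂² = c²s⁴ + s¹⁰`, `y = c s³ + s⁴`; with
`v(T) = −4` every generator `f T^d` of `P(E)(1)` has `v ≥ 0` while `v(y T) = 3 − 4 < 0`. [folklore] -/
theorem D_arc (c s : K) :
    (c * s ^ 3 + s ^ 4) ^ 2 + (c ^ 2 + s ^ 6) * (s ^ 2) ^ 3 = s ^ 8 + s ^ 12 ∧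
      (c ^ 2 + s ^ 6) * (s ^ 2) ^ 2 = c ^ 2 * s ^ 4 + s ^ 10 := by
  constructor
  · ring_nf
    reduce_mod_char!
  · ring

/-! ## Example B: `g = y² + x₁³x₂³` -/

/-- Taylor expansion of `g_B = y² + x₁³x₂³` (characteristic 2). Read off: `∂_{x₁}g = x₁²x₂³`,
`∂_{x₂}g = x₁³x₂²`, `∂_y g = 0`, `∂^{(1,1)}g = x₁²x₂²`, `∂^{(2,2)}g = x₁x₂`. [folklore] -/
theorem B_taylor (x₁ x₂ y u v w : K) :
    (y + w) ^ 2 + (x₁ + u) ^ 3 * (x₂ + v) ^ 3 =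
      (y ^ 2 + x₁ ^ 3 * x₂ ^ 3) + w ^ 2
        + x₁ ^ 2 * x₂ ^ 3 * u + x₁ * x₂ ^ 3 * u ^ 2 + x₂ ^ 3 * u ^ 3
        + x₁ ^ 3 * x₂ ^ 2 * v + x₁ ^ 2 * x₂ ^ 2 * (u * v) + x₁ * x₂ ^ 2 * (u ^ 2 * v) + x₂ ^ 2 * (u ^ 3 * v)
        + x₁ ^ 3 * x₂ * v ^ 2 + x₁ ^ 2 * x₂ * (u * v ^ 2) + x₁ * x₂ * (u ^ 2 * v ^ 2) + x₂ * (u ^ 3 * v ^ 2)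
        + x₁ ^ 3 * v ^ 3 + x₁ ^ 2 * (u * v ^ 3) + x₁ * (u ^ 2 * v ^ 3) + u ^ 3 * v ^ 3 := by
  ring_nf
  reduce_mod_char!

omit [CharP K 2] in
/-- I_B (H♭): case (I) for `ε = x₁³x₂³` (`α = (1,1)`, `γ₀ = (1,1)`, `|qγ₀| = 4 ≥ 2q`):
`H♭(ε) = ∂^{(1,1)}ε · ∂^{(2,2)}ε = x₁²x₂² · x₁x₂ = ε`, tail `y` (`g − H = y²`), and POS_B:
`H = x₁ · ∂_{x₁}g`. [folklore] -/
theorem B_hflat (x₁ x₂ y : K) :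
    x₁ ^ 2 * x₂ ^ 2 * (x₁ * x₂) = x₁ ^ 3 * x₂ ^ 3 ∧ (y ^ 2 + x₁ ^ 3 * x₂ ^ 3) - x₁ ^ 3 * x₂ ^ 3 = y ^ 2 ∧
      x₁ ^ 3 * x₂ ^ 3 = x₁ * (x₁ ^ 2 * x₂ ^ 3) := by
  refine ⟨by ring, by ring, by ring⟩

/-- NEG-LSB_B (three point blow-ups from the origin, all in the `x₁`-chart; the second centre is the
point `x₂ = 1` of the exceptional line): the three chart identities in characteristic 2. [folklore] -/
theorem B_neg_steps (x₁ x₂ y : K) :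
    (x₁ * y) ^ 2 + x₁ ^ 3 * (x₁ * x₂) ^ 3 = x₁ ^ 2 * (y ^ 2 + x₁ ^ 4 * x₂ ^ 3) ∧
    (x₁ * y) ^ 2 + x₁ ^ 4 * (1 + x₁ * x₂) ^ 3 =
      x₁ ^ 2 * (y ^ 2 + x₁ ^ 2 + x₁ ^ 3 * x₂ + x₁ ^ 4 * x₂ ^ 2 + x₁ ^ 5 * x₂ ^ 3) ∧
    (x₁ * y) ^ 2 + x₁ ^ 2 + x₁ ^ 3 * (x₁ * x₂) + x₁ ^ 4 * (x₁ * x₂) ^ 2 + x₁ ^ 5 * (x₁ * x₂) ^ 3 =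
      x₁ ^ 2 * (y ^ 2 + 1 + x₁ ^ 2 * x₂ + x₁ ^ 4 * x₂ ^ 2 + x₁ ^ 6 * x₂ ^ 3) := by
  refine ⟨by ring, ?_, by ring⟩
  ring_nf
  reduce_mod_char!

/-- NEG-LSB_B, witness: at `(0,0,1)` of the third chart `g₃(u,v,1+w) = w² + u²v + u⁴v² + u⁶v³`
(order 2, in `Sing`), and the transformed tail `y` has the value `1` there. [folklore] -/
theorem B_neg_witness (u v w : K) :
    (1 + w) ^ 2 + 1 + u ^ 2 * v + u ^ 4 * v ^ 2 + u ^ 6 * v ^ 3 = w ^ 2 + u ^ 2 * v + u ^ 4 * v ^ 2 + u ^ 6 * v ^ 3 := by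
  ring_nf
  reduce_mod_char!

/-- NEG-VAL_B (line point `(c²,0,0)`, arc `(c²+s⁶, s², c³s³+s⁴)`): `g = s⁸ + (higher)` exactly
`g = s⁸ + c⁴s¹² + s²⁴`... computed: `y² = c⁶s⁶ + s⁸`, `x₁³x₂³ = (c²+s⁶)³ s⁶`; the identity below
gives `g` along the arc; `v(g) = 8`, `v(∂_{x₂}g) = v(x₁³x₂²) = 4`, so `v(T) = −4` and
`v(yT) = 3 − 4 < 0`. [folklore] -/
theorem B_arc (c s : K) :
    (c ^ 3 * s ^ 3 + s ^ 4) ^ 2 + (c ^ 2 + s ^ 6) ^ 3 * (s ^ 2) ^ 3 =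
      s ^ 8 + c ^ 4 * s ^ 12 + c ^ 2 * s ^ 18 + s ^ 24 := by
  ring_nf
  reduce_mod_char!

/-! ## Example C: the transform at `ξ′_b`

Coordinates at `ξ′_b = (0, b, 0)`, `b = c²`, of the `x₁`-chart of the blow-up of `y² + x₁x₂³` at the
origin: `g′ = y′² + x₁²x₂′³`, `s := x₂′ − c²`, edge parameter `y″ := y′ + c³x₁`. -/

omit [CharP K 2] in
/-- The chart identity producing `C` from `D`: `g(x₁, x₁x₂′, x₁y′) = x₁²(y′² + x₁²x₂′³)`. [folklore] -/
theorem C_chart (x₁ x₂' y' : K) :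
    (x₁ * y') ^ 2 + x₁ * (x₁ * x₂') ^ 3 = x₁ ^ 2 * (y' ^ 2 + x₁ ^ 2 * x₂' ^ 3) := by ring

/-- The edge form at `ξ′_b`: with `x₂′ = c² + s` and `y′ = y″ + c³x₁` (characteristic 2),
`g′ = y″² + ε′`, `ε′ = x₁²(s³ + c²s² + c⁴s)` (order 3 > 2 = q). [folklore] -/
theorem C_edge_form (x₁ s y'' c : K) :
    (y'' + c ^ 3 * x₁) ^ 2 + x₁ ^ 2 * (c ^ 2 + s) ^ 3 =
      y'' ^ 2 + x₁ ^ 2 * (s ^ 3 + c ^ 2 * s ^ 2 + c ^ 4 * s) := by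
  ring_nf
  reduce_mod_char!

/-- Taylor expansion of `ε′ = x₁²(s³ + c²s² + c⁴s)` in the increments `(u, v)` of `(x₁, s)`
(characteristic 2). Read off: `∂^{(0,1)}ε′ = x₁²(s² + c⁴)` (coefficient of `v`),
`∂^{(2,2)}ε′ = s + c²` (coefficient of `u²v²`), `∂^{(1,0)}ε′ = 0`. [folklore] -/
theorem C_taylor (x₁ s c u v : K) :
    (x₁ + u) ^ 2 * ((s + v) ^ 3 + c ^ 2 * (s + v) ^ 2 + c ^ 4 * (s + v)) =
      x₁ ^ 2 * (s ^ 3 + c ^ 2 * s ^ 2 + c ^ 4 * s)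
        + x₁ ^ 2 * (s ^ 2 + c ^ 4) * v + x₁ ^ 2 * (s + c ^ 2) * v ^ 2 + x₁ ^ 2 * v ^ 3
        + (s ^ 3 + c ^ 2 * s ^ 2 + c ^ 4 * s) * u ^ 2 + (s ^ 2 + c ^ 4) * (u ^ 2 * v)
        + (s + c ^ 2) * (u ^ 2 * v ^ 2) + u ^ 2 * v ^ 3 := by
  ring_nf
  reduce_mod_char!

/-- **I_C** (the registered identity): with `ε′ = x₁²(s³+c²s²+c⁴s)` and the case-(I) knock-out
`H♭(ε′) = ∂^{(0,1)}ε′ · ∂^{(2,2)}ε′ = x₁²(s²+c⁴)·(s+c²)`, one has `H♭(ε′) = x₁²(s+c²)³ = ε′ + c⁶x₁²`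
(so `ord H♭ = 2 < 3 = ord ε′` when `c ≠ 0`), `y″² + ε′ − H♭(ε′) = (y″ + c³x₁)²`, and the tail
`y″ + c³x₁` equals `y′` (characteristic 2); `y(e) − y″ = c³x₁ ∉ max²`. [folklore] -/
theorem C_identity (x₁ s y'' c : K) :
    x₁ ^ 2 * (s ^ 2 + c ^ 4) * (s + c ^ 2) = x₁ ^ 2 * (s + c ^ 2) ^ 3 ∧
    x₁ ^ 2 * (s ^ 2 + c ^ 4) * (s + c ^ 2) = x₁ ^ 2 * (s ^ 3 + c ^ 2 * s ^ 2 + c ^ 4 * s) + c ^ 6 * x₁ ^ 2 ∧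
    y'' ^ 2 + x₁ ^ 2 * (s ^ 3 + c ^ 2 * s ^ 2 + c ^ 4 * s) - x₁ ^ 2 * (s ^ 2 + c ^ 4) * (s + c ^ 2) =
      (y'' + c ^ 3 * x₁) ^ 2 ∧
    (y'' + c ^ 3 * x₁) + c ^ 3 * x₁ = y'' := by
  refine ⟨?_, ?_, ?_, ?_⟩ <;> ring_nf <;> reduce_mod_char!

/-- POS_C in chart coordinates: `g′ = y′² + x₁²x₂′³` has `∂_{x₂′}g′ = x₁²x₂′²`, `∂_{x₁}g′ = 0`
(characteristic 2; Taylor expansion below) and `H♭ = x₁²(s+c²)³ = x₁²x₂′³ = x₂′ · ∂_{x₂′}g′`. [folklore] -/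
theorem C_pos (x₁ x₂' y' u v w : K) :
    (y' + w) ^ 2 + (x₁ + u) ^ 2 * (x₂' + v) ^ 3 =
      (y' ^ 2 + x₁ ^ 2 * x₂' ^ 3) + w ^ 2 + x₁ ^ 2 * x₂' ^ 2 * v + x₁ ^ 2 * x₂' * v ^ 2 + x₁ ^ 2 * v ^ 3
        + x₂' ^ 3 * u ^ 2 + x₂' ^ 2 * (u ^ 2 * v) + x₂' * (u ^ 2 * v ^ 2) + u ^ 2 * v ^ 3 ∧
    x₁ ^ 2 * x₂' ^ 3 = x₂' * (x₁ ^ 2 * x₂' ^ 2) := by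
  constructor
  · ring_nf
    reduce_mod_char!
  · ring

omit [CharP K 2] in
/-- NEG-LSB_C: blow-up of `ξ′_b`, `x₁`-chart `(x₁, x₁s, x₁y″)`:
`g′(x₁, x₁s, x₁y″) = x₁² · g₂`, `g₂ = y″² + c⁴sx₁ + c²s²x₁² + s³x₁³`; `g₂` has no constant and
no linear part at the chart origin (order 2: the origin is in `Sing`), and the tail
`y′ = y″ + c³x₁` transforms to `x₁ · (y″ + c³)`, whose strict transform `y″ + c³` takes the value
`c³` at that point — nonzero for `c ≠ 0` in a domain. [folklore] -/
theorem C_neg (x₁ s y'' c : K) :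
    (x₁ * y'') ^ 2 + x₁ ^ 2 * ((x₁ * s) ^ 3 + c ^ 2 * (x₁ * s) ^ 2 + c ^ 4 * (x₁ * s)) =
      x₁ ^ 2 * (y'' ^ 2 + c ^ 4 * s * x₁ + c ^ 2 * s ^ 2 * x₁ ^ 2 + s ^ 3 * x₁ ^ 3) ∧
    x₁ * y'' + c ^ 3 * x₁ = x₁ * (y'' + c ^ 3) := by
  constructor <;> ring

omit [CharP K 2] in
/-- NEG-VAL_C (arc `(x₁, s, y″) = (σ, σ, σ²)`, i.e. `y′ = c³σ + σ²`): along the arc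
`g′ = c⁴σ³ + (c²+1)σ⁴ + σ⁵`... precisely the identity below; `v(g′) = 3`, `v(∂_s g′) = v(x₁²(s²+c⁴)) = 2`,
so `v(T) = −3/2` and `v(y′T) = 1 − 3/2 < 0`. [folklore] -/
theorem C_arc (c σ : K) :
    (σ ^ 2) ^ 2 + σ ^ 2 * (σ ^ 3 + c ^ 2 * σ ^ 2 + c ^ 4 * σ) = c ^ 4 * σ ^ 3 + (c ^ 2 + 1) * σ ^ 4 + σ ^ 5 ∧
      σ ^ 2 * (σ ^ 2 + c ^ 4) = c ^ 4 * σ ^ 2 + σ ^ 4 := by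
  constructor <;> ring

end Identities

section Pointwise

/-! The pointwise statements below hold over every field (characteristic 2 is where they are used). -/

variable {K : Type*} [Field K]

/-- Example B, `Sing(Ě) = V(g, ∂g)` pointwise: over a field of characteristic 2,
`y² + x₁³x₂³ = 0 ∧ x₁²x₂³ = 0 ∧ x₁³x₂² = 0 ↔ y = 0 ∧ (x₁ = 0 ∨ x₂ = 0)` — two lines crossing at
the origin (G-c: the terminal object `∇` of this example is this set, not a smooth irreducible
subscheme). [folklore] -/
theorem B_sing_pointwise (x₁ x₂ y : K) :
    (y ^ 2 + x₁ ^ 3 * x₂ ^ 3 = 0 ∧ x₁ ^ 2 * x₂ ^ 3 = 0 ∧ x₁ ^ 3 * x₂ ^ 2 = 0) ↔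
      (y = 0 ∧ (x₁ = 0 ∨ x₂ = 0)) := by
  constructor
  · rintro ⟨hg, h1, _⟩
    have hx : x₁ = 0 ∨ x₂ = 0 := by
      rcases mul_eq_zero.mp h1 with h | h
      · exact Or.inl (pow_eq_zero_iff (by norm_num) |>.mp h)
      · exact Or.inr (pow_eq_zero_iff (by norm_num) |>.mp h)
    refine ⟨?_, hx⟩
    rcases hx with h | h <;> simpa [h] using hg
  · rintro ⟨hy, hx⟩
    rcases hx with h | h <;> simp [hy, h]

/-- Example D, `Sing(Ě) = V(g, ∂g)` pointwise: `y² + x₁x₂³ = 0 ∧ x₂³ = 0 ∧ x₁x₂² = 0 ↔ y = 0 ∧ x₂ = 0`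
— the `x₁`-axis (= `∇` of this example). [folklore] -/
theorem D_sing_pointwise (x₁ x₂ y : K) :
    (y ^ 2 + x₁ * x₂ ^ 3 = 0 ∧ x₂ ^ 3 = 0 ∧ x₁ * x₂ ^ 2 = 0) ↔ (y = 0 ∧ x₂ = 0) := by
  constructor
  · rintro ⟨hg, h2, _⟩
    have hx : x₂ = 0 := pow_eq_zero_iff (by norm_num) |>.mp h2
    exact ⟨by simpa [hx] using hg, hx⟩
  · rintro ⟨hy, hx⟩
    simp [hy, hx]

/-- Example B, `Sing` of `F(Y) = ((x₁³x₂³), 2)` on `Y = {y = 0}` pointwise (value and first Hasse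
derivatives vanish): `x₁³x₂³ = 0 ∧ x₁²x₂³ = 0 ∧ x₁³x₂² = 0 ↔ x₁ = 0 ∨ x₂ = 0` — the two crossing lines
that form `∇` in Example B. [folklore] -/
theorem B_nabla_pointwise (x₁ x₂ : K) :
    (x₁ ^ 3 * x₂ ^ 3 = 0 ∧ x₁ ^ 2 * x₂ ^ 3 = 0 ∧ x₁ ^ 3 * x₂ ^ 2 = 0) ↔ (x₁ = 0 ∨ x₂ = 0) := by
  constructor
  · rintro ⟨_, h1, _⟩
    rcases mul_eq_zero.mp h1 with h | h
    · exact Or.inl (pow_eq_zero_iff (by norm_num) |>.mp h)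
    · exact Or.inr (pow_eq_zero_iff (by norm_num) |>.mp h)
  · rintro (h | h) <;> simp [h]

/-- Example B, Step (2) of the proof of Th 15.10 would need `J(0) ⊂ (y)²`; but `g = y² + x₁³x₂³`
does not vanish at the point `(1,1,0)` where every element of `(y)²` vanishes: `g(1,1,0) = 1 ≠ 0`. [folklore] -/
theorem B_J0_not_in_ysq : ((0 : K) ^ 2 + (1 : K) ^ 3 * (1 : K) ^ 3) ≠ 0 := by
  simp

end Pointwise

end Summit.ResolutionOfSingularities.ResolutionOfSingularities.Theorems.Campaign.K13
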